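import Literature.NumberTheory.Automorphic.HilbertRepMultiplicitySpace
import Literature.NumberTheory.Automorphic.ProductGroupMultiplicityRep
import HarnessLib

/-!
# The two norms on the multiplicity space `Hom_H(τ, ρ)`: Hilbert–Schmidt versus operator norm

Topic `Literature/NumberTheory/Automorphic` (`HilbertRepSpectrum` vocabulary).  Definitions with bodies (the identity map as a
linear / continuous linear equivalence, and as an equivalence of representations) and theorems; no named fact.

The multiplicity space `Hom_H(τ, ρ)` of intertwiners from a finite-dimensional `V_τ` carries the operator norm
(`Schur.intertwiners τ ρ ≤ (V_τ →L X)`, used by `ContRepresentation.multiplicityRep`, `ProductGroupMultiplicityRep`) and the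
Hilbert–Schmidt inner product `Σᵢ ⟪S eᵢ, T eᵢ⟫` (`ContRepresentation.HomSpace`, used by `ContRepresentation.homRep`,
`HilbertRepMultiplicitySpace`; Deitmar–Echterhoff Lemma 7.3.1).  On a source of dimension `d` they are equivalent:
`‖S‖_HS ≤ √d ‖S‖_op` and `‖S‖_op ≤ d ‖S‖_HS`, so the identity is a continuous linear equivalence intertwining the two
`G`-actions `(g·T) = U(g, 1) ∘ T` (Bröcker–tom Dieck II (4.14), proof).

* `HomSpace.norm_toCLM_apply_basis_le`, `HomSpace.norm_sq_le`, `HomSpace.norm_le` — `‖S eᵢ‖ ≤ ‖S‖_op`, `‖S‖_HS ≤ √d ‖S‖_op`;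
* `HomSpace.norm_toCLM_apply_le`, `HomSpace.norm_toCLM_le` — `‖S f‖ ≤ d ‖S‖_HS ‖f‖`, `‖S‖_op ≤ d ‖S‖_HS`;
* `HomSpace.toIntertwinersₗ`, `HomSpace.toIntertwinersL` — **the identity `Hom_H(τ, ρ)_HS ≃ Hom_H(τ, ρ)_op`** as a (continuous)
  linear equivalence;
* `ContRepresentation.homRepEquivMultiplicityRep` — **`Θ(τ)_HS ≃ Θ(τ)_op` as representations of `G`**
  (`ContRepresentation.Equiv (U.homRep τ) (U.multiplicityRep τ)`).

## References
* A. Deitmar, S. Echterhoff, *Principles of Harmonic Analysis*, 2nd ed. (2014), §7.3 Lemma 7.3.1, PDF p. 197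
  [DeitmarEchterhoff2014].
* T. Bröcker, T. tom Dieck, *Representations of Compact Lie Groups*, GTM 98 (1985), II Prop (4.14) proof, PDF p. 80
  [BrockerTomDieck1985].

## Provenance
Lane `lit-hodgefound` (HOME `run/shared/lean/pub/lit-hodgefound/`), prover seat `lit-hodgefound-p05` generation 7 (Layer 0,
beneath C2-08 / C2-10).
-/

noncomputable section

open ContinuousLinearMap
open Literature.RepresentationTheory.CompactGroups Literature.NumberTheory.Automorphic
open scoped InnerProductSpace

namespace ContRepresentation

namespace HomSpace

section Norms

variable {H : Type*} [Group H]
variable {X : Type*} [NormedAddCommGroup X] [InnerProductSpace ℂ X]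
variable {F : Type*} [NormedAddCommGroup F] [InnerProductSpace ℂ F]
variable {τ : ContRepresentation ℂ H F} {ρ : ContRepresentation ℂ H X}

/-- The identity `Hom_H(τ, ρ)_HS ≃ₗ Hom_H(τ, ρ)_op` as a linear equivalence (same vectors, same operators).
[cite: DeitmarEchterhoff2014, Lemma 7.3.1] -/
def toIntertwinersₗ : HomSpace τ ρ ≃ₗ[ℂ] Schur.intertwiners τ ρ where
  toFun S := ⟨S.toCLM, S.toCLM_mem⟩
  invFun T := HomSpace.mk (T : F →L[ℂ] X) T.2
  map_add' _ _ := rfl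
  map_smul' _ _ := rfl
  left_inv _ := rfl
  right_inv _ := rfl

/-- `toIntertwinersₗ S` has the same underlying operator. [cite: DeitmarEchterhoff2014, Lemma 7.3.1] -/
@[simp]
theorem coe_toIntertwinersₗ (S : HomSpace τ ρ) : ((toIntertwinersₗ S : Schur.intertwiners τ ρ) : F →L[ℂ] X) = S.toCLM :=
  rfl

/-- `toIntertwinersₗ.symm T` has the same underlying operator. [cite: DeitmarEchterhoff2014, Lemma 7.3.1] -/
@[simp]
theorem toCLM_toIntertwinersₗ_symm (T : Schur.intertwiners τ ρ) :
    ((toIntertwinersₗ (τ := τ) (ρ := ρ)).symm T).toCLM = (T : F →L[ℂ] X) :=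
  rfl

variable [FiniteDimensional ℂ F]

/-- `‖S eᵢ‖ ≤ ‖S‖_op` (the basis vectors have norm one). [cite: DeitmarEchterhoff2014, Lemma 7.3.1] -/
theorem norm_toCLM_apply_basis_le (S : HomSpace τ ρ) (i : Fin (Module.finrank ℂ F)) :
    ‖S.toCLM (stdOrthonormalBasis ℂ F i)‖ ≤ ‖S.toCLM‖ := by
  have h := S.toCLM.le_opNorm (stdOrthonormalBasis ℂ F i)
  rwa [(stdOrthonormalBasis ℂ F).norm_eq_one i, mul_one] at h

/-- **`‖S‖_HS² ≤ d · ‖S‖_op²`**, `d = dim V_τ`. [cite: DeitmarEchterhoff2014, Lemma 7.3.1] -/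
theorem norm_sq_le (S : HomSpace τ ρ) : ‖S‖ ^ 2 ≤ Module.finrank ℂ F * ‖S.toCLM‖ ^ 2 := by
  rw [norm_sq_eq]
  calc ∑ i, ‖S.toCLM (stdOrthonormalBasis ℂ F i)‖ ^ 2 ≤ ∑ _i : Fin (Module.finrank ℂ F), ‖S.toCLM‖ ^ 2 :=
        Finset.sum_le_sum fun i _ => pow_le_pow_left₀ (norm_nonneg _) (S.norm_toCLM_apply_basis_le i) 2
    _ = Module.finrank ℂ F * ‖S.toCLM‖ ^ 2 := by
        rw [Finset.sum_const, Finset.card_univ, Fintype.card_fin, nsmul_eq_mul]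

/-- **`‖S‖_HS ≤ √d · ‖S‖_op`.** [cite: DeitmarEchterhoff2014, Lemma 7.3.1] -/
theorem norm_le (S : HomSpace τ ρ) : ‖S‖ ≤ Real.sqrt (Module.finrank ℂ F) * ‖S.toCLM‖ := by
  refine le_of_sq_le_sq ?_ (mul_nonneg (Real.sqrt_nonneg _) (norm_nonneg _))
  rw [mul_pow, Real.sq_sqrt (Nat.cast_nonneg _)]
  exact S.norm_sq_le

/-- **`‖S f‖ ≤ d · ‖S‖_HS · ‖f‖`**: expand `f = Σᵢ ⟪eᵢ, f⟫ eᵢ` and use `|⟪eᵢ, f⟫| ≤ ‖f‖`, `‖S eᵢ‖ ≤ ‖S‖_HS`.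
[cite: DeitmarEchterhoff2014, Lemma 7.3.1] -/
theorem norm_toCLM_apply_le (S : HomSpace τ ρ) (f : F) :
    ‖S.toCLM f‖ ≤ Module.finrank ℂ F * ‖S‖ * ‖f‖ := by
  set b := stdOrthonormalBasis ℂ F with hb
  have hf : S.toCLM f = ∑ i, ⟪b i, f⟫_ℂ • S.toCLM (b i) := by
    conv_lhs => rw [← b.sum_repr' f]
    rw [map_sum]
    exact Finset.sum_congr rfl fun i _ => by rw [map_smul]
  rw [hf]
  calc ‖∑ i, ⟪b i, f⟫_ℂ • S.toCLM (b i)‖ ≤ ∑ i, ‖⟪b i, f⟫_ℂ • S.toCLM (b i)‖ := norm_sum_le _ _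
    _ ≤ ∑ _i : Fin (Module.finrank ℂ F), ‖S‖ * ‖f‖ := by
        refine Finset.sum_le_sum fun i _ => ?_
        rw [norm_smul]
        have h1 : ‖⟪b i, f⟫_ℂ‖ ≤ ‖f‖ := by
          have h := norm_inner_le_norm (𝕜 := ℂ) (b i) f
          rwa [b.norm_eq_one i, one_mul] at h
        have h2 : ‖S.toCLM (b i)‖ ≤ ‖S‖ := S.norm_apply_le i
        calc ‖⟪b i, f⟫_ℂ‖ * ‖S.toCLM (b i)‖ ≤ ‖f‖ * ‖S‖ :=
              mul_le_mul h1 h2 (norm_nonneg _) (norm_nonneg _)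
          _ = ‖S‖ * ‖f‖ := mul_comm _ _
    _ = Module.finrank ℂ F * ‖S‖ * ‖f‖ := by
        rw [Finset.sum_const, Finset.card_univ, Fintype.card_fin, nsmul_eq_mul, mul_assoc]

/-- **`‖S‖_op ≤ d · ‖S‖_HS`.** [cite: DeitmarEchterhoff2014, Lemma 7.3.1] -/
theorem norm_toCLM_le (S : HomSpace τ ρ) : ‖S.toCLM‖ ≤ Module.finrank ℂ F * ‖S‖ :=
  ContinuousLinearMap.opNorm_le_bound _ (mul_nonneg (Nat.cast_nonneg _) (norm_nonneg _)) S.norm_toCLM_apply_le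

/-- **The identity `Hom_H(τ, ρ)_HS ≃L Hom_H(τ, ρ)_op`**: the Hilbert–Schmidt space and the operator-norm subspace
`Schur.intertwiners τ ρ` are the same vector space with equivalent norms (`‖S‖_op ≤ d ‖S‖_HS`, `‖S‖_HS ≤ √d ‖S‖_op`).
[cite: DeitmarEchterhoff2014, Lemma 7.3.1] -/
def toIntertwinersL : HomSpace τ ρ ≃L[ℂ] Schur.intertwiners τ ρ :=
  (toIntertwinersₗ (τ := τ) (ρ := ρ)).toContinuousLinearEquivOfBounds (Module.finrank ℂ F) (Real.sqrt (Module.finrank ℂ F))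
    (fun S => norm_toCLM_le S) (fun T => norm_le (HomSpace.mk (T : F →L[ℂ] X) T.2))

/-- `toIntertwinersL S` has the same underlying operator. [cite: DeitmarEchterhoff2014, Lemma 7.3.1] -/
@[simp]
theorem coe_toIntertwinersL (S : HomSpace τ ρ) : ((toIntertwinersL S : Schur.intertwiners τ ρ) : F →L[ℂ] X) = S.toCLM :=
  rfl

/-- `toIntertwinersL.symm T` has the same underlying operator. [cite: DeitmarEchterhoff2014, Lemma 7.3.1] -/
@[simp]
theorem toCLM_toIntertwinersL_symm (T : Schur.intertwiners τ ρ) :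
    ((toIntertwinersL (τ := τ) (ρ := ρ)).symm T).toCLM = (T : F →L[ℂ] X) :=
  rfl

end Norms

end HomSpace

/-! ### The two models of `Θ(τ)` are equivalent representations of `G` -/

section Product

variable {G H : Type*} [Group G] [Group H]
variable {X : Type*} [NormedAddCommGroup X] [InnerProductSpace ℂ X]
variable {F : Type*} [NormedAddCommGroup F] [InnerProductSpace ℂ F] [FiniteDimensional ℂ F]

/-- **`Θ(τ)_HS ≃ Θ(τ)_op` as representations of `G`**: the identity intertwines `ContRepresentation.homRep` (Hilbert–Schmidt
model) and `ContRepresentation.multiplicityRep` (operator-norm model), both being `(g·T) = U(g, 1) ∘ T`.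
[cite: BrockerTomDieck1985, II Prop (4.14)] [cite: DeitmarEchterhoff2014, Lemma 7.3.1] -/
def homRepEquivMultiplicityRep (U : ContRepresentation ℂ (G × H) X) (τ : ContRepresentation ℂ H F) :
    ContRepresentation.Equiv (U.homRep τ) (U.multiplicityRep τ) :=
  ContRepresentation.Equiv.mk HomSpace.toIntertwinersL fun g => by
    refine ContinuousLinearMap.ext fun S => Subtype.ext ?_
    rw [ContinuousLinearMap.comp_apply, ContinuousLinearMap.comp_apply]
    change ((HomSpace.toIntertwinersL (U.homRep τ g S) : Schur.intertwiners τ (U.restrict (MonoidHom.inr G H))) :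
        F →L[ℂ] X) = ((U.multiplicityRep τ g (HomSpace.toIntertwinersL S) : Schur.intertwiners τ
          (U.restrict (MonoidHom.inr G H))) : F →L[ℂ] X)
    rw [HomSpace.coe_toIntertwinersL, multiplicityRep_apply_coe, HomSpace.coe_toIntertwinersL, toCLM_homRep_apply]

/-- The equivalence does not change the underlying operator. [cite: BrockerTomDieck1985, II Prop (4.14)] -/
theorem coe_homRepEquivMultiplicityRep_apply (U : ContRepresentation ℂ (G × H) X) (τ : ContRepresentation ℂ H F)
    (S : HomSpace τ (U.restrict (MonoidHom.inr G H))) :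
    ((homRepEquivMultiplicityRep U τ S : Schur.intertwiners τ (U.restrict (MonoidHom.inr G H))) : F →L[ℂ] X) = S.toCLM :=
  rfl

end Product

end ContRepresentation

end
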